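import Literature.AlgebraicGeometry.Frobenioids.ArchimedeanFrobeniusAmple
import HarnessLib

/-!
# Frobenioids II, Example 3.3 (ii): every object of `C` is Frobenius-isotropic — PROOF

Mochizuki, *The geometry of Frobenioids II: poly-Frobenioids*, Kyushu J. Math. **62** (2008)
401–460, §3, Example 3.3 (ii), author's text p. 28 [cite: MochizukiFrdII2008, Ex 3.3 (ii) p.28]:
"by Lemma 3.2, (v), every object of `C` is Frobenius-isotropic [cf. [Mzk5], Definition 1.2, (iv)]".

PROVED here (`Ex33ii_frobeniusIsotropic_holds`): for an object `X` with angular part the open arc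
`B`, the `n`-th power map is surjective `B → S¹` for `n` large (Lemma 3.2 (v): an arc of length
`ℓ > 0` has `n`-th power of length `nℓ > 2π`, via abc-iut-L1-t7's `CircleOpensArcs`), so the arrow
`φ = (id, n, 1) : X → X_n` to the isotropic object `X_n` of tip `tip(A_X)^n` over the same base data is
a morphism of Frobenius type with isotropic codomain: a base-isomorphism, an isometry, and CO-ANGULAR —
in any factorisation `γ ≫ β ≫ α = φ` with `β`, `α` linear, `γ` has degree `n`, so the codomain of `γ`
receives `c_γ · A_X^{⊗n}`, which meets every direction; it is therefore isotropic and the isometric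
pre-step `β` out of it is an isomorphism (`Ex33ii_isotropic_iff_holds`).
-/

namespace Literature.AlgebraicGeometry.Frobenioids

open CategoryTheory Complex
open scoped Pointwise

noncomputable section

namespace ArchFrd

/-- **Lemma 3.2 (v)-type surjectivity**: for every angular region `A` of `ℂ^×` there is `n ≥ 1` such
that `z ↦ zⁿ` maps the angular part `B` ONTO `S¹`. [cite: MochizukiFrdII2008, Lem 3.2 (v) p.25] -/
theorem AngularRegion.exists_pow_surjOn (A : AngularRegion ℂ) :
    ∃ n : ℕ+, ∀ w : normOneSubgroup ℂ, ∃ z ∈ A.dir, z ^ (n : ℕ) = w := by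
  by_cases hA : A.IsIsotropic
  · refine ⟨1, fun w => ⟨w, ?_, by rw [PNat.one_coe, pow_one]⟩⟩
    rw [show A.dir = Set.univ from hA]; trivial
  obtain ⟨c, d, hcd, -, hB'⟩ := CircleOpens.exists_eq_exp_image_Ioo (isConnected_image_dir A)
    (isOpen_image_dir A) (image_dir_ne_univ A hA)
  -- `n (d - c) > 2π`
  obtain ⟨n, hn⟩ := exists_nat_gt (2 * Real.pi / (d - c))
  have hdc : 0 < d - c := by linarith
  have hnpos : 0 < n := by
    have : (0 : ℝ) < n := lt_trans (div_pos Real.two_pi_pos hdc) hn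
    exact_mod_cast this
  refine ⟨⟨n, hnpos⟩, fun w => ?_⟩
  have hlen : 2 * Real.pi < (n : ℝ) * d - (n : ℝ) * c := by
    rw [← mul_sub]; rwa [div_lt_iff₀ hdc] at hn
  have hw : toCircleHom w ∈ Circle.exp '' Set.Ioo ((n : ℝ) * c) ((n : ℝ) * d) := by
    rw [CircleOpens.exp_image_Ioo_eq_univ hlen]; trivial
  obtain ⟨x, hx, hxw⟩ := hw
  have hnr : (0 : ℝ) < n := by exact_mod_cast hnpos
  have hy : x / n ∈ Set.Ioo c d :=
    ⟨by rw [lt_div_iff₀ hnr]; linarith [hx.1], by rw [div_lt_iff₀ hnr]; linarith [hx.2]⟩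
  have hmem : Circle.exp (x / n) ∈ toCircleHom '' A.dir := by rw [hB']; exact ⟨_, hy, rfl⟩
  obtain ⟨z, hz, hzexp⟩ := hmem
  refine ⟨z, hz, toCircleHom_injective ?_⟩
  change toCircleHom (z ^ n) = toCircleHom w
  rw [map_pow, hzexp, ← circleExp_nat_mul, mul_div_cancel₀ _ hnr.ne', hxw]

/-- The angular part of `c · (z · t)ⁿ` is `ĉ · zⁿ` (`z ∈ S¹`, `t > 0`).
[cite: MochizukiFrdII2008, Def 3.1 (ii) p.24] -/
theorem unitPart_mul_pow_coe_mul_ofPosReal (c : ℂˣ) (z : normOneSubgroup ℂ) (t : PosReal) (n : ℕ) :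
    unitPart ℂ (c * ((z : ℂˣ) * ofPosReal ℂ t) ^ n) = unitPart ℂ c * z ^ n := by
  rw [unitPart_mul]
  congr 1
  induction n with
  | zero =>
    rw [pow_zero, pow_zero]
    have h := unitPart_coe_normOne (1 : normOneSubgroup ℂ)
    rwa [OneMemClass.coe_one] at h
  | succ k ih => rw [pow_succ, pow_succ, unitPart_mul, ih, unitPart_coe_mul_ofPosReal]

namespace C0

variable (X : C0)

/-- The isotropic object `X_n` of tip `tip(A_X)ⁿ` over the base of `X`.
[cite: MochizukiFrdII2008, Ex 3.3 (ii) p.28] -/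
def powTarget (n : ℕ+) : C0 :=
  ⟨X.base, AngularRegion.isotropicOfTip (X.region.tip ^ (n : ℕ)),
    fun _ => AngularRegion.isIsotropic_isotropicOfTip _⟩

/-- `X_n` is naively isotropic. [cite: MochizukiFrdII2008, Ex 3.3 (ii) p.28] -/
theorem isNaivelyIsotropic_powTarget (n : ℕ+) : (powTarget X n).IsNaivelyIsotropic :=
  AngularRegion.isIsotropic_isotropicOfTip _

/-- The tip of `X_n` is `tip(A_X)ⁿ`. [cite: MochizukiFrdII2008, Ex 3.3 (ii) p.28] -/
theorem tip_powTarget (n : ℕ+) : (powTarget X n).tip = X.tip ^ (n : ℕ) := by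
  change (((X.region.tip ^ (n : ℕ) : PosReal)) : ℝ) = (X.region.tip : ℝ) ^ (n : ℕ)
  rw [Positive.val_pow]

/-- The arrow `(id, n, 1) : X → X_n`. [cite: MochizukiFrdII2008, Ex 3.3 (ii) p.28] -/
def powHom (n : ℕ+) : X ⟶ powTarget X n where
  base := 𝟙 _
  degFr := n
  scalar := 1
  scalar_mem := one_mem _
  mapsTo := by
    rw [one_smul]
    change X.region.carrier ^ (n : ℕ) ⊆ pullRegion (powTarget X n) (𝟙 (powTarget X n).base)
    rw [pullRegion_id]
    intro u hu
    rw [mem_carrier_of_isIsotropic (isNaivelyIsotropic_powTarget X n), ← Subtype.coe_le_coe, coe_absHom]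
    change ‖(u : ℂ)‖ ≤ (powTarget X n).tip
    rw [tip_powTarget]
    exact norm_le_of_mem_carrier_pow X.region _ u hu

/-- `(id, n, 1) : X → X_n` is an isometry. [cite: MochizukiFrdII2008, Ex 3.3 (ii) p.28] -/
theorem isIsometry_powHom (n : ℕ+) : PreFrobenioid.IsIsometry C0.toElem (powHom X n) := by
  refine (A0.isIsometry_iff_norm_mul_tip_pow _).mpr ?_
  change ‖((1 : ℂˣ) : ℂ)‖ * X.tip ^ (n : ℕ) = (powTarget X n).tip
  rw [Units.val_one, norm_one, one_mul, tip_powTarget]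

variable {X}

/-- If `zⁿ` ranges over all of `S¹` for `z ∈ B_X`, then the codomain of ANY arrow of degree `n` out
of `X` is naively isotropic. [cite: MochizukiFrdII2008, Ex 3.3 (ii) p.28] -/
theorem isNaivelyIsotropic_of_hom_of_pow_surj {Y : C0} (γ : X ⟶ Y)
    (hsurj : ∀ w : normOneSubgroup ℂ, ∃ z ∈ X.region.dir, z ^ (degFr γ : ℕ) = w) :
    Y.IsNaivelyIsotropic := by
  refine Set.eq_univ_of_forall fun w => ?_
  -- an element of `A_X` with prescribed direction `z ∈ B_X`
  have ha : ∀ z : normOneSubgroup ℂ, z ∈ X.region.dir →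
      (z : ℂˣ) * ofPosReal ℂ X.region.tip ∈ X.region.carrier := fun z hz => by
    refine ⟨?_, ?_⟩
    · rw [unitPart_coe_mul_ofPosReal]; exact hz
    · have h2 : absHom ℂ ((z : ℂˣ) * ofPosReal ℂ X.region.tip) = X.region.tip :=
        (Prod.ext_iff.mp ((unitDecomposition ℂ).symm_apply_apply (z, X.region.tip))).2
      exact h2.le
  -- the point of `A_Y` under `c · aⁿ`, according to the twist of `Base γ`
  have hpt : ∀ z : normOneSubgroup ℂ, z ∈ X.region.dir → ∃ p ∈ Y.region.carrier,
      D0.galAct (D0.Hom.twists (Base γ)) p =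
        scalar γ * ((z : ℂˣ) * ofPosReal ℂ X.region.tip) ^ (degFr γ : ℕ) := fun z hz => by
    obtain ⟨p, hp, hpe⟩ := γ.mapsTo (Set.smul_mem_smul_set (Set.pow_mem_pow (ha z hz)))
    exact ⟨p, hp, hpe⟩
  cases hσ : D0.Hom.twists (Base γ) with
  | false =>
    obtain ⟨z, hz, hzw⟩ := hsurj ((unitPart ℂ (scalar γ))⁻¹ * w)
    obtain ⟨p, hp, hpe⟩ := hpt z hz
    rw [hσ, D0.galAct_false] at hpe
    have hw : unitPart ℂ p = w := by
      rw [hpe, unitPart_mul_pow_coe_mul_ofPosReal, hzw, mul_inv_cancel_left]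
    rw [← hw]
    exact hp.1
  | true =>
    obtain ⟨z, hz, hzw⟩ := hsurj ((unitPart ℂ (scalar γ))⁻¹ * w⁻¹)
    obtain ⟨p, hp, hpe⟩ := hpt z hz
    rw [hσ] at hpe
    have hp' : p = D0.galAct true (scalar γ * ((z : ℂˣ) * ofPosReal ℂ X.region.tip) ^ (degFr γ : ℕ)) := by
      rw [← hpe]; exact (D0.galAct_galAct _ _).symm
    have hw : unitPart ℂ p = w := by
      rw [hp', unitPart_galAct_true, unitPart_mul_pow_coe_mul_ofPosReal, hzw, mul_inv_cancel_left,
        inv_inv]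
    rw [← hw]
    exact hp.1

end C0

universe v u

variable {D : Type u} [Category.{v} D] (π : D ⥤ D0)

/-- **Example 3.3 (ii)**: every object of `C` is Frobenius-isotropic — PROVED (the arrow
`(id, n, 1) : X → X_n` for `n` as in Lemma 3.2 (v) is of Frobenius type with isotropic codomain).
[cite: MochizukiFrdII2008, Ex 3.3 (ii) p.28] -/
theorem Ex33ii_frobeniusIsotropic_holds : Ex33ii_frobeniusIsotropic π := by
  intro X
  obtain ⟨n, hn⟩ := X.fst.region.exists_pow_surjOn
  let B : C π := ⟨C0.powTarget X.fst n, X.snd, X.iso⟩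
  let φ : X ⟶ B := ⟨C0.powHom X.fst n, 𝟙 X.snd, by
    change 𝟙 _ ≫ X.iso.hom = X.iso.hom ≫ π.map (𝟙 X.snd)
    rw [Category.id_comp, CategoryTheory.Functor.map_id, Category.comp_id]⟩
  have hB : PreFrobenioid.IsIsotropic (C.toElem π) B :=
    (Ex33ii_isotropic_iff_holds π B).mpr (C0.isNaivelyIsotropic_powTarget X.fst n)
  refine ⟨B, φ, ⟨⟨?_, C0.isIsometry_powHom X.fst n⟩, ?_⟩, hB⟩
  · -- co-angular: the codomain of `γ` in any factorisation is isotropic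
    intro P Q γ β α hfac hlin hisom hpre _
    have hdeg : C0.degFr γ.fst = n := by
      have h1 : C0.degFr (γ ≫ β ≫ α).fst = n := by rw [hfac]; rfl
      have hβ : C0.degFr β.fst = 1 := hpre.1
      have hα : C0.degFr α.fst = 1 := hlin
      change C0.degFr (γ.fst ≫ β.fst ≫ α.fst) = n at h1
      rwa [C0.degFr_comp', C0.degFr_comp', hβ, hα, mul_one, mul_one] at h1
    have hP : P.fst.IsNaivelyIsotropic :=
      C0.isNaivelyIsotropic_of_hom_of_pow_surj γ.fst (by rw [hdeg]; exact hn)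
    exact (Ex33ii_isotropic_iff_holds π P).mpr hP β hisom hpre
  · change IsIso (𝟙 X.snd)
    infer_instance



end ArchFrd

end

end Literature.AlgebraicGeometry.Frobenioids
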